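import Mathlib.Algebra.BigOperators.Finprod
import Mathlib.Algebra.BigOperators.Ring.Finset
import Mathlib.Data.Complex.Basic
import HarnessLib

/-!
# The gluing sum of the H-side count: `Σ_{j ≤ N} w(j) = 1 + (q+1)(1 + q + ⋯ + q^{N−1}) = (q^N(q+1) − 2)∕(q − 1)`, its parity split, and the two-class
# `finsum` shape (Flicker 1998, §6 p. 95 and REMARK)

Topic `NumberTheory/Automorphic`; namespace `Literature.NumberTheory.Automorphic.HSideGluingSum`.  THEOREMS ONLY (no definition, no instance, no notation, no
named fact, no `sorry`).  Cell `pub/hodgecm-mathlib`, F0∕P3a road «D-N7-inert», brick **(L5-d2)** of the H-side count (L5) (B-p10 (g24) PRE-CENSUS bf72064b4f0257e1 §2 (vi);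
LEAD F0P3a-plan (g9) T8-35 (C)).  HC_CM is proved only modulo the printed citations until rung 0 closes; nothing printed is a letter here — this is the ARITHMETIC TAIL
and the FINSUM SHAPE of the assembly (L5-d), independent of the lattice files (L5-a)∕(L5-b)∕(L5-c)∕(L5-e), so that the final head is an `exact` over named pieces.

THE PRINT [Flicker1998UnitaryFL, §6 p. 95]: «`Φ^st_{1_{K_H}}(t₀) = Φ_H(t₁) + Φ_H(t₂)` … `= (q^N(q+1) − 2)∕(q − 1)`»; REMARK (Mars): the weights are `1` (`j = 0`) and `q^{j−1}(q+1)`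
(`0 < j ≤ N`).  In the eigenframe route the class `t₁` (even Gram parity) collects the EVEN gaps `j`, the class `t₂` the ODD ones (PRE-CENSUS §2 (v)–(vi)).
The GLUING WEIGHT is written inline, `w q j := if j = 0 then 1 else q ^ (j − 1) * (q + 1)` (no definition).

* §1 `sum_gluingWeight_eq` (`Σ_{j ≤ N} w = 1 + (q+1) Σ_{i<N} q^i`), **`pred_mul_sum_gluingWeight_add_two`** (`(q − 1)·Σ + 2 = q^N (q+1)` in `ℕ`, `1 ≤ q`),
  **`cast_sum_gluingWeight_eq_div`** (in a field of characteristic `0`, `2 ≤ q`: `Σ = (q^N(q+1) − 2)∕(q − 1)`).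
* §2 `sum_gluingWeight_eq_even_add_odd` (the parity split of `Σ_{j ≤ N}`).
* §3 **`finsum_mem_pair_eq_div_of_eq_parity_sums`** — if a class function `Φ` takes the values `Σ_{j ≤ N, j even} w` and `Σ_{j ≤ N, j odd} w` (cast to `ℂ`) on two
  distinct classes `c₀ ≠ c₁`, then `∑ᶠ c ∈ {c₀, c₁}, Φ c = ((q^N(q+1) − 2)∕(q − 1) : ℂ)` — the shape of ★ `stableOrbitalIntegralRel` (`∑ᶠ` over the classes of the stable class)
  at the H-side of the inert unit fundamental lemma.

## References
* [Flicker1998UnitaryFL] Y. Z. Flicker, *Elementary proof of the fundamental lemma for a unitary group*, Canad. J. Math. 50 (1998), §6 p. 95 and REMARK.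
* [Rogawski1990] J. D. Rogawski, *Automorphic Representations of Unitary Groups in Three Variables* (1990), §4.9 Lemma 4.9.3 p. 61.
-/

set_option autoImplicit false

open Finset

namespace Literature.NumberTheory.Automorphic.HSideGluingSum

/-! ## §1 The gluing sum and its closed form -/

/-- `Σ_{j ≤ N} w(j) = 1 + (q+1)·Σ_{i<N} q^i` for the gluing weights `w(0) = 1`, `w(j) = q^{j−1}(q+1)`. [cite: Flicker1998UnitaryFL, §6 p. 95 REMARK] -/
theorem sum_gluingWeight_eq (q N : ℕ) :
    ∑ j ∈ range (N + 1), (if j = 0 then 1 else q ^ (j - 1) * (q + 1)) = 1 + (q + 1) * ∑ i ∈ range N, q ^ i := by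
  induction N with
  | zero => simp
  | succ N ih =>
    rw [Finset.sum_range_succ, ih, Finset.sum_range_succ, if_neg (Nat.succ_ne_zero N), Nat.succ_sub_one]
    ring

/-- **`(q − 1)·Σ_{j ≤ N} w(j) + 2 = q^N (q + 1)`** (`1 ≤ q`): the division-free form of Flicker's `(q^N(q+1) − 2)∕(q − 1)`. [cite: Flicker1998UnitaryFL, §6 p. 95] -/
theorem pred_mul_sum_gluingWeight_add_two {q : ℕ} (hq : 1 ≤ q) (N : ℕ) :
    (q - 1) * (∑ j ∈ range (N + 1), (if j = 0 then 1 else q ^ (j - 1) * (q + 1))) + 2 = q ^ N * (q + 1) := by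
  rw [sum_gluingWeight_eq]
  obtain ⟨d, rfl⟩ := Nat.exists_eq_add_of_le' hq
  rw [Nat.add_sub_cancel]
  -- `d · Σ_{i<N} (d+1)^i + 1 = (d+1)^N`
  have geo : d * ∑ i ∈ range N, (d + 1) ^ i + 1 = (d + 1) ^ N := by
    induction N with
    | zero => simp
    | succ N ih => rw [Finset.sum_range_succ, mul_add, add_right_comm, ih]; ring
  calc d * (1 + (d + 1 + 1) * ∑ i ∈ range N, (d + 1) ^ i) + 2
      = (d + 1 + 1) * (d * ∑ i ∈ range N, (d + 1) ^ i + 1) := by ring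
    _ = (d + 1) ^ N * (d + 1 + 1) := by rw [geo, mul_comm]

/-- **`Σ_{j ≤ N} w(j) = (q^N(q+1) − 2)∕(q − 1)`** in any field of characteristic `0`, for `2 ≤ q` (Flicker: «`Φ^st_{1_{K_H}}(t₀) = (q^N(q+1) − 2)∕(q − 1)`»).
[cite: Flicker1998UnitaryFL, §6 p. 95] -/
theorem cast_sum_gluingWeight_eq_div {K : Type*} [Field K] [CharZero K] {q : ℕ} (hq : 2 ≤ q) (N : ℕ) :
    ((∑ j ∈ range (N + 1), (if j = 0 then 1 else q ^ (j - 1) * (q + 1)) : ℕ) : K) = ((q : K) ^ N * (q + 1) - 2) / (q - 1) := by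
  have hq1 : (q : K) - 1 ≠ 0 := by
    rw [sub_ne_zero]; exact_mod_cast (show q ≠ 1 by omega)
  rw [eq_div_iff hq1]
  have h := congrArg (fun n : ℕ => (n : K)) (pred_mul_sum_gluingWeight_add_two (le_trans (by norm_num) hq) N)
  simp only [Nat.cast_add, Nat.cast_mul, Nat.cast_pow, Nat.cast_ofNat, Nat.cast_one, Nat.cast_sub (le_trans (by norm_num) hq : 1 ≤ q)] at h
  rw [← h]
  ring

/-! ## §2 The parity split -/

/-- `Σ_{j ≤ N} w(j) = Σ_{j ≤ N, j even} w(j) + Σ_{j ≤ N, j odd} w(j)`. [cite: Flicker1998UnitaryFL, §6 p. 95] -/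
theorem sum_gluingWeight_eq_even_add_odd (q N : ℕ) :
    ∑ j ∈ range (N + 1), (if j = 0 then 1 else q ^ (j - 1) * (q + 1)) =
      ∑ j ∈ (range (N + 1)).filter (fun j => j % 2 = 0), (if j = 0 then 1 else q ^ (j - 1) * (q + 1)) +
        ∑ j ∈ (range (N + 1)).filter (fun j => j % 2 = 1), (if j = 0 then 1 else q ^ (j - 1) * (q + 1)) := by
  rw [← Finset.sum_filter_add_sum_filter_not (range (N + 1)) (fun j => j % 2 = 0)]
  congr 2
  ext j
  simp only [Finset.mem_filter, Nat.mod_two_ne_zero]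

/-! ## §3 The two-class `finsum` shape -/

/-- A `finsum` over a two-element set of classes. [cite: Flicker1998UnitaryFL, §6 p. 95] -/
theorem finsum_mem_pair_eq_add {α : Type*} {c₀ c₁ : α} (h : c₀ ≠ c₁) (Φ : α → ℂ) :
    ∑ᶠ c ∈ ({c₀, c₁} : Set α), Φ c = Φ c₀ + Φ c₁ :=
  finsum_mem_pair h

/-- **THE H-SIDE ASSEMBLY SHAPE.**  If a class function `Φ` (the class orbital integral of `1_{K_H}`) takes on two distinct classes `c₀ ≠ c₁` (the two `H_v`-classes of the stable
class, Flicker's `t₁, t₂`) the values `Σ_{j ≤ N, j even} w(j)` and `Σ_{j ≤ N, j odd} w(j)` (the self-dual `γ`-stable lattice counts of the two Gram parities), then the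
stable sum over `{c₀, c₁}` is Flicker's `(q^N(q+1) − 2)∕(q − 1)`. [cite: Flicker1998UnitaryFL, §6 p. 95] [cite: Rogawski1990, §4.9 Lemma 4.9.3 p. 61] -/
theorem finsum_mem_pair_eq_div_of_eq_parity_sums {α : Type*} {c₀ c₁ : α} (h : c₀ ≠ c₁) (Φ : α → ℂ) {q : ℕ} (hq : 2 ≤ q) (N : ℕ)
    (h₀ : Φ c₀ = ((∑ j ∈ (range (N + 1)).filter (fun j => j % 2 = 0), (if j = 0 then 1 else q ^ (j - 1) * (q + 1)) : ℕ) : ℂ))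
    (h₁ : Φ c₁ = ((∑ j ∈ (range (N + 1)).filter (fun j => j % 2 = 1), (if j = 0 then 1 else q ^ (j - 1) * (q + 1)) : ℕ) : ℂ)) :
    ∑ᶠ c ∈ ({c₀, c₁} : Set α), Φ c = ((q : ℂ) ^ N * (q + 1) - 2) / (q - 1) := by
  rw [finsum_mem_pair_eq_add h, h₀, h₁, ← Nat.cast_add, ← sum_gluingWeight_eq_even_add_odd, cast_sum_gluingWeight_eq_div hq]

/-- The same with the roles of the two classes exchanged (`c₀` odd, `c₁` even). [cite: Flicker1998UnitaryFL, §6 p. 95] -/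
theorem finsum_mem_pair_eq_div_of_eq_parity_sums' {α : Type*} {c₀ c₁ : α} (h : c₀ ≠ c₁) (Φ : α → ℂ) {q : ℕ} (hq : 2 ≤ q) (N : ℕ)
    (h₀ : Φ c₀ = ((∑ j ∈ (range (N + 1)).filter (fun j => j % 2 = 1), (if j = 0 then 1 else q ^ (j - 1) * (q + 1)) : ℕ) : ℂ))
    (h₁ : Φ c₁ = ((∑ j ∈ (range (N + 1)).filter (fun j => j % 2 = 0), (if j = 0 then 1 else q ^ (j - 1) * (q + 1)) : ℕ) : ℂ)) :
    ∑ᶠ c ∈ ({c₀, c₁} : Set α), Φ c = ((q : ℂ) ^ N * (q + 1) - 2) / (q - 1) := by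
  rw [Set.pair_comm]
  exact finsum_mem_pair_eq_div_of_eq_parity_sums h.symm Φ hq N h₁ h₀

end Literature.NumberTheory.Automorphic.HSideGluingSum
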